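import Literature.Topology.FourManifolds.TautFoliationsSquarePolar
import Mathlib.Topology.Homotopy.Path
import HarnessLib

/-!
# The disc map of a null-homotopic closed family of loops, with the family as collar

Sibling of `TautFoliationsSquarePolar.lean`. Data: a family of loops `Φ θ τ` (`θ ∈ [0, 1]`,
`τ` between `τ₀` and `τ₁`, jointly continuous, closed: `Φ 1 τ = Φ 0 τ`) and a null-homotopy `H`
of the loop `θ ↦ Φ θ τ₀` in `M`. We build a continuous map `G` of the plane (the **collar
disc**) which, on the collar `L / 2 ≤ dist(x, c₀) ≤ L` of the square `closedBall c₀ L`, is the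
loop of the family at the level `lev (dist x c₀)` read at the angle of `x`, with `lev` affine on
`[3L/4, L]` from `τ₁` to `τ₀` (and back to `τ₁ → τ₀` is not needed: on `[L/2, 3L/4]` the levels
return from `τ₁` to `τ₀`), and which inside is the null-homotopy followed by the constant. This
is the disc to be coned in the proof of Novikov's theorem when the essential loop has trivial
holonomy with essential nearby lifts (the fence of the loop as collar).

* `levelOf`, `angleParam` (**definitions**), `exists_collarDisc` (**proved**): continuity of
  `G`, the collar formula `G x = Φ (angleParam c₀ x) (levelOf τ₀ τ₁ L (dist x c₀))`, the
  boundary levels, and the **descent property of the angle parameter**: for every continuous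
  `g` on `[0, 1]` with `g 0 = g 1`, `g ∘ angleParam c₀` is continuous off `c₀`.

All statements are [folklore].
-/

noncomputable section

open Set Filter Metric Topology Function Real unitInterval

namespace Literature.Topology.FourManifolds

namespace SquarePolar

variable {M : Type*} [TopologicalSpace M]

/-! ## The angle parameter in `[0, 1]` -/

/-- The loop parameter `θ(t) = t / 2π`, clamped to `[0, 1]`. [folklore] -/
def loopParam (t : ℝ) : I := projIcc 0 1 zero_le_one (t / (2 * π))

/-- `loopParam` is continuous. [folklore] -/
theorem continuous_loopParam : Continuous loopParam :=
  continuous_projIcc.comp (continuous_id.div_const _)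

/-- `loopParam 0 = 0`. [folklore] -/
@[simp] theorem loopParam_zero : loopParam 0 = 0 := by
  simp [loopParam]

/-- `loopParam (2π) = 1`. [folklore] -/
@[simp] theorem loopParam_two_pi : loopParam (2 * π) = 1 := by
  rw [loopParam, div_self (ne_of_gt Real.two_pi_pos)]
  exact projIcc_right _

/-- **The angle parameter** of `x` about `c₀`, in `[0, 1]`: the representative in `[0, 2π)` of
the angle, divided by `2π`. [folklore] -/
def angleParam (c₀ x : ℝ × ℝ) : I := loopParam (AddCircle.equivIco (2 * π) 0 (ang c₀ x) : ℝ)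

/-- The representative of the angle. [folklore] -/
theorem coe_rep_ang (c₀ x : ℝ × ℝ) : ((AddCircle.equivIco (2 * π) 0 (ang c₀ x) : ℝ) : Real.Angle) = ang c₀ x :=
  AddCircle.coe_equivIco

/-- The representative lies in `[0, 2π)`. [folklore] -/
theorem rep_ang_mem (c₀ x : ℝ × ℝ) : (AddCircle.equivIco (2 * π) 0 (ang c₀ x) : ℝ) ∈ Ico 0 (2 * π) := by
  have h := (AddCircle.equivIco (2 * π) 0 (ang c₀ x)).2
  refine ⟨h.1, ?_⟩
  have h2 := h.2
  linarith

/-- **Descent property of the angle parameter**: a continuous function on `[0, 1]` with equal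
end values, composed with the angle parameter, is continuous off the centre. [folklore] -/
theorem continuousOn_comp_angleParam {Z : Type*} [TopologicalSpace Z] {g : I → Z} (hg : Continuous g) (h01 : g 0 = g 1)
    (c₀ : ℝ × ℝ) : ContinuousOn (g ∘ angleParam c₀) {c₀}ᶜ := by
  -- descend `t ↦ g (loopParam t)` to the circle
  set K : ℝ → Unit → Z := fun t _ ↦ g (loopParam t) with hK
  have hKc : ContinuousOn (uncurry K) (Icc 0 (2 * π) ×ˢ univ) :=
    ((hg.comp continuous_loopParam).comp continuous_fst).continuousOn
  have hper : ∀ u, K 0 u = K (2 * π) u := fun u ↦ by simp [hK, h01]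
  have hdesc := continuous_descend hKc hper
  intro x hx
  have heq : ∀ y, (g ∘ angleParam c₀) y = descend K (ang c₀ y, ()) := fun y ↦ by
    conv_rhs => rw [← coe_rep_ang c₀ y]
    rw [descend_coe K (rep_ang_mem c₀ y)]
    rfl
  have hc : ContinuousAt (fun y ↦ descend K (ang c₀ y, ())) x :=
    hdesc.continuousAt.comp ((continuousAt_ang hx).prodMk continuousAt_const)
  exact (hc.congr (Eventually.of_forall fun y ↦ (heq y).symm)).continuousWithinAt

/-! ## The level function on the collar -/

/-- **The level at distance `r`**: affine in the collar parameter `s = 1 - r / L`, from `τ₀` at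
`s = 0` to `τ₁` at `s = 1/4` and back to `τ₀` at `s = 1/2` (clamped). [folklore] -/
def levelOfParam (τ₀ τ₁ s : ℝ) : ℝ := τ₀ + (τ₁ - τ₀) * projIcc 0 1 zero_le_one (4 * min s (1 / 2 - s))

/-- `levelOfParam` is continuous. [folklore] -/
theorem continuous_levelOfParam (τ₀ τ₁ : ℝ) : Continuous (levelOfParam τ₀ τ₁) := by
  unfold levelOfParam
  exact continuous_const.add (continuous_const.mul (continuous_subtype_val.comp
    (continuous_projIcc.comp (continuous_const.mul (continuous_id.min (continuous_const.sub continuous_id))))))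

/-- `levelOfParam` takes values between `τ₀` and `τ₁`. [folklore] -/
theorem levelOfParam_mem (τ₀ τ₁ s : ℝ) : levelOfParam τ₀ τ₁ s ∈ uIcc τ₀ τ₁ := by
  unfold levelOfParam
  set u := (projIcc 0 1 zero_le_one (4 * min s (1 / 2 - s)) : ℝ) with hu
  have hu0 : 0 ≤ u := (projIcc 0 1 zero_le_one _).2.1
  have hu1 : u ≤ 1 := (projIcc 0 1 zero_le_one _).2.2
  rcases le_total τ₀ τ₁ with h | h
  · rw [uIcc_of_le h]; constructor <;> nlinarith
  · rw [uIcc_of_ge h]; constructor <;> nlinarith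

/-- At `s = 0` the level is `τ₀`. [folklore] -/
theorem levelOfParam_zero (τ₀ τ₁ : ℝ) : levelOfParam τ₀ τ₁ 0 = τ₀ := by
  simp [levelOfParam]

/-- On `[0, 1/4]` the level is the affine function `τ₀ + 4 s (τ₁ - τ₀)`. [folklore] -/
theorem levelOfParam_of_le {τ₀ τ₁ s : ℝ} (hs0 : 0 ≤ s) (hs : s ≤ 1 / 4) : levelOfParam τ₀ τ₁ s = τ₀ + (τ₁ - τ₀) * (4 * s) := by
  unfold levelOfParam
  rw [min_eq_left (by linarith), projIcc_of_mem _ ⟨by linarith, by linarith⟩]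

/-- At `s = 1/2` the level is back to `τ₀`. [folklore] -/
theorem levelOfParam_half (τ₀ τ₁ : ℝ) : levelOfParam τ₀ τ₁ (1 / 2) = τ₀ := by
  simp [levelOfParam]

/-! ## The collar disc -/

variable {Φ : I → ℝ → M} {τ₀ τ₁ : ℝ} {x₀ : M}

/-- **The collar disc of a null-homotopic closed family of loops.** See the module docstring.
[folklore] -/
theorem exists_collarDisc (hcont : ContinuousOn (uncurry Φ) (univ ×ˢ uIcc τ₀ τ₁)) (hcl : ∀ τ ∈ uIcc τ₀ τ₁, Φ 1 τ = Φ 0 τ)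
    (γ : Path x₀ x₀) (hγ : ∀ θ, γ θ = Φ θ τ₀) (H : Path.Homotopy γ (Path.refl x₀)) (c₀ : ℝ × ℝ) {L : ℝ} (hL : 0 < L) :
    ∃ G : ℝ × ℝ → M, Continuous G ∧
      ∀ x, L / 2 ≤ dist x c₀ → G x = Φ (angleParam c₀ x) (levelOfParam τ₀ τ₁ (1 - dist x c₀ / L)) := by
  classical
  -- the family: levels of `Φ` for `s ≤ 1/2`, then the null-homotopy, then the constant
  set K : ℝ → ℝ → M := fun t s ↦ if s ≤ 1 / 2 then Φ (loopParam t) (levelOfParam τ₀ τ₁ s)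
    else H (projIcc 0 1 zero_le_one (4 * s - 2), loopParam t) with hK
  have hΦc : Continuous fun p : ℝ × ℝ ↦ Φ (loopParam p.1) (levelOfParam τ₀ τ₁ p.2) := by
    have h := hcont.comp_continuous ((continuous_loopParam.comp continuous_fst).prodMk
      ((continuous_levelOfParam τ₀ τ₁).comp continuous_snd)) fun p ↦ ⟨mem_univ _, levelOfParam_mem τ₀ τ₁ p.2⟩
    exact h
  have hHc : Continuous fun p : ℝ × ℝ ↦ H (projIcc 0 1 zero_le_one (4 * p.2 - 2), loopParam p.1) :=
    H.continuous.comp ((continuous_projIcc.comp ((continuous_const.mul continuous_snd).sub continuous_const)).prodMk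
      (continuous_loopParam.comp continuous_fst))
  have hKc : Continuous (uncurry K) := by
    have h : Continuous fun p : ℝ × ℝ ↦ if p.2 ≤ 1 / 2 then Φ (loopParam p.1) (levelOfParam τ₀ τ₁ p.2)
        else H (projIcc 0 1 zero_le_one (4 * p.2 - 2), loopParam p.1) := by
      refine continuous_if_le continuous_snd continuous_const hΦc.continuousOn hHc.continuousOn fun p hp ↦ ?_
      rw [hp, levelOfParam_half, show (4 : ℝ) * (1 / 2) - 2 = 0 by norm_num, projIcc_left, ← hγ]
      exact (H.apply_zero _).symm
    exact h
  have hper : ∀ s, K 0 s = K (2 * π) s := fun s ↦ by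
    simp only [hK, loopParam_zero, loopParam_two_pi]
    split_ifs with hs
    · exact (hcl _ (levelOfParam_mem τ₀ τ₁ s)).symm
    · rw [H.eq_fst _ (by simp : (0 : I) ∈ ({0, 1} : Set I)), H.eq_fst _ (by simp : (1 : I) ∈ ({0, 1} : Set I))]
      show γ 0 = γ 1
      rw [γ.source, γ.target]
  -- the constant tail
  have htail : ∀ t s, 3 / 4 ≤ s → K t s = x₀ := fun t s hs ↦ by
    simp only [hK, if_neg (show ¬ s ≤ 1 / 2 by linarith)]
    rw [projIcc_of_right_le _ (by linarith), show (⟨1, right_mem_Icc.2 zero_le_one⟩ : I) = 1 from rfl, H.apply_one]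
    rfl
  refine ⟨polarMap K c₀ L, ?_, fun x hx ↦ ?_⟩
  · -- continuity
    refine continuous_iff_continuousAt.2 fun x ↦ ?_
    by_cases hx : x = c₀
    · rw [hx]
      exact continuousAt_polarMap_centre hL (by norm_num : (3 : ℝ) / 4 < 1) htail
    · exact (continuousOn_polarMap hKc.continuousOn hper x hx).continuousAt (isOpen_compl_singleton.mem_nhds hx)
  · -- the collar formula
    rw [polarMap_of_ang (rep_ang_mem c₀ x) (coe_rep_ang c₀ x).symm]
    have hs : 1 - dist x c₀ / L ≤ 1 / 2 := by
      rw [sub_le_comm, le_div_iff₀ hL]; linarith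
    simp only [hK, if_pos hs]
    rfl

end SquarePolar

end Literature.Topology.FourManifolds
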